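import Mathlib.Combinatorics.SimpleGraph.Coloring.Vertex
import Mathlib.Algebra.Ring.Hom.Defs
import Mathlib.Tactic.Ring
import HarnessLib

/-!
# The unit-circle Cayley graph of a commutative ring and its functoriality — the algebraic half of the reduction principle

Framing (verbatim for the cell): lottery ticket; floor = certified bounds/negative ranges.

For a commutative ring `A`, `unitCircleGraph A` is the graph on `A × A` in which `x ~ y` iff `x ≠ y` and the difference
`x − y = (a, b)` lies on the unit circle `a² + b² = 1`.  For `A = ℝ` restricted to a subring this is the unit-distance graph of
the plane on those points; for `A = ZMod 11` it is the 121-vertex graph 5-coloured by kernel computation in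
`FiniteFieldObstruction.lean` (census file of the same seat).  The point of this file is the one-line REDUCTION PRINCIPLE
behind the field obstruction `χ(ℚ(√3,√5,√11)²) = 5` of the (U) census: a ring homomorphism `ρ : A →+* B` (with `B`
nontrivial) maps unit vectors to unit vectors, hence induces a graph homomorphism `unitCircleGraph A →g unitCircleGraph B`,
and so `χ(unitCircleGraph A) ≤ χ(unitCircleGraph B)`; more generally any graph whose vertices carry coordinates in `A × A`
with adjacent vertices at "unit distance" (`hadj`) is `n`-colourable as soon as `unitCircleGraph B` is.  Applied with
`A = ℤ[1/6][√3, √5, √11]` (all census graphs of families F1/F2/W3mix/TH/FL/TRI2 have coordinates there), `B = ZMod 11`,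
`ρ(√3) = 5, ρ(√5) = 4, ρ(√11) = 0`, this is why every such graph is 5-colourable.  (The existence of that `ρ`, i.e. that the
eight monomials `√(3^a 5^b 11^c)` are ℚ-linearly independent, is elementary but not formalised here.)
-/

namespace Summit.Ventures.DiscreteObjects.UnitDistance

open SimpleGraph

/-- The unit-circle Cayley graph of a commutative ring `A`: vertices `A × A`, `x ~ y` iff `x ≠ y` and
`(x₁ − y₁)² + (x₂ − y₂)² = 1`. -/
def unitCircleGraph (A : Type*) [CommRing A] : SimpleGraph (A × A) where
  Adj x y := x ≠ y ∧ (x.1 - y.1) ^ 2 + (x.2 - y.2) ^ 2 = 1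
  symm := ⟨fun x y h => by
    obtain ⟨hne, h⟩ := h
    refine ⟨hne.symm, ?_⟩
    have e1 : (y.1 - x.1) ^ 2 = (x.1 - y.1) ^ 2 := by ring
    have e2 : (y.2 - x.2) ^ 2 = (x.2 - y.2) ^ 2 := by ring
    rw [e1, e2]; exact h⟩
  loopless := ⟨fun x h => h.1 rfl⟩

/-- Unfolding lemma for adjacency in `unitCircleGraph A`. -/
theorem unitCircleGraph_adj {A : Type*} [CommRing A] (x y : A × A) :
    (unitCircleGraph A).Adj x y ↔ x ≠ y ∧ (x.1 - y.1) ^ 2 + (x.2 - y.2) ^ 2 = 1 := Iff.rfl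

/-- In a nontrivial ring two points whose difference lies on the unit circle are distinct (the origin is not on the
unit circle since `0 ≠ 1`). -/
theorem ne_of_sq_add_sq_eq_one {B : Type*} [CommRing B] [Nontrivial B] {x y : B × B}
    (h : (x.1 - y.1) ^ 2 + (x.2 - y.2) ^ 2 = 1) : x ≠ y := by
  rintro rfl
  simp at h

/-- REDUCTION PRINCIPLE (coordinate form).  Let `G` be any graph whose vertices carry coordinates `p v ∈ A × A` such that
adjacent vertices are at "unit distance" in `A` (`hadj`).  Then every ring homomorphism `ρ : A →+* B` into a nontrivial
commutative ring gives a graph homomorphism `G →g unitCircleGraph B`, `v ↦ (ρ (p v).1, ρ (p v).2)`. -/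
def homUnitCircleGraphOfRingHom {V A B : Type*} [CommRing A] [CommRing B] [Nontrivial B] {G : SimpleGraph V}
    (p : V → A × A) (hadj : ∀ ⦃v w : V⦄, G.Adj v w → ((p v).1 - (p w).1) ^ 2 + ((p v).2 - (p w).2) ^ 2 = 1)
    (ρ : A →+* B) : G →g unitCircleGraph B where
  toFun v := (ρ (p v).1, ρ (p v).2)
  map_rel' := by
    intro v w hvw
    have h := congrArg ρ (hadj hvw)
    simp only [map_add, map_pow, map_sub, map_one] at h
    exact ⟨ne_of_sq_add_sq_eq_one h, h⟩

/-- REDUCTION PRINCIPLE (colouring form).  With the data of `homUnitCircleGraphOfRingHom`: if `unitCircleGraph B` is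
`n`-colourable then so is `G`.  (Census use: `B = ZMod 11`, `n = 5`.) -/
theorem colorable_of_ringHom_unitCircleGraph {V A B : Type*} [CommRing A] [CommRing B] [Nontrivial B]
    {G : SimpleGraph V} (p : V → A × A)
    (hadj : ∀ ⦃v w : V⦄, G.Adj v w → ((p v).1 - (p w).1) ^ 2 + ((p v).2 - (p w).2) ^ 2 = 1)
    (ρ : A →+* B) {n : ℕ} (hB : (unitCircleGraph B).Colorable n) : G.Colorable n :=
  hB.of_hom (homUnitCircleGraphOfRingHom p hadj ρ)

/-- Functoriality: a ring homomorphism `ρ : A →+* B` (with `B` nontrivial) induces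
`unitCircleGraph A →g unitCircleGraph B`; hence `χ(unitCircleGraph A) ≤ χ(unitCircleGraph B)`. -/
def unitCircleGraph.map {A B : Type*} [CommRing A] [CommRing B] [Nontrivial B] (ρ : A →+* B) :
    unitCircleGraph A →g unitCircleGraph B :=
  homUnitCircleGraphOfRingHom (G := unitCircleGraph A) id (fun _ _ h => h.2) ρ

/-- `χ(unitCircleGraph A) ≤ n` whenever some nontrivial ring quotient/image `B` of `A` has `χ(unitCircleGraph B) ≤ n`. -/
theorem unitCircleGraph_colorable_of_ringHom {A B : Type*} [CommRing A] [CommRing B] [Nontrivial B] (ρ : A →+* B)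
    {n : ℕ} (hB : (unitCircleGraph B).Colorable n) : (unitCircleGraph A).Colorable n :=
  hB.of_hom (unitCircleGraph.map ρ)

end Summit.Ventures.DiscreteObjects.UnitDistance
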